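import Literature.Computability.Complexity.SymbolPrograms
import Literature.Computability.FineGrained.FineGrainedWave0
import HarnessLib

/-!
# The sparsification algorithm as a stack program, I: registers, encodings, literal routines

Family `fine-grained` (trunk T-CPLX-FINE). First part of the implementation of the algorithm
`Reduce` of Impagliazzo–Paturi–Zane (*Which problems have strongly exponential complexity?*,
JCSS 63 (2001), §2) as a structured stack program over the alphabet `Γ'` of the k-CNF encoding
(`SymbolPrograms.lean`), towards the time bound in the named fact
`Literature.Computability.FineGrained.sparsification` (**fine-grained.S05**). This file fixes

* the register file `Sparsifier.K` of the whole program;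
* the word encodings of the data: a literal `(i, b)` is the *body* `bit b, bit i₀, …`
  (`litBody`; `KCNF.encodeLiteral = litBody ++ [comma]`), a clause is held as the *clause body*
  `cbody c = c.flatMap encodeLiteral` (its literals, each closed by a comma), a family of clauses
  as `wFam F = F.flatMap encodeClause` (`bra … ket` blocks), a work-list of families as
  `wWL L` (families separated by `blank`);
* the literal- and clause-level routines with their specifications and step bounds
  (`ACom.Runs`): `normFlag` (normalise a flag register to `[]`/`[blank]`), `eqXY` (equality of
  the literal held reversed in `x` with the one held reversed in `y`), `memXC` (membership of
  the literal in `x` in the clause body held in `c`), `subDC` (inclusion of the clause body in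
  `d` in the one in `c`), and the register utilities `copyFwd`, `swap`, `pourCount`;
* two generic pass combinators with their invariant lemmas: `litPass` / `runs_litPass` (over a
  clause body, literal by literal, running an action at each comma) and `famPass` /
  `runs_famPass` (over a family word, clause by clause, running an action at each closing
  bracket) — every loop of the program over structured register contents is an instance.

All routines preserve their *probe* operands (restoring them through a scratch register) and
consume their *stream* operands, and leave every scratch register empty, so that specifications
compose by `Function.update` bookkeeping only. Orientation conventions: a probe literal is held
*reversed* (as accumulated from a stack), clause bodies and family words are held in reading
order.

## References

* R. Impagliazzo, R. Paturi, F. Zane, *Which problems have strongly exponential complexity?*,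
  J. Comput. Syst. Sci. 63 (2001) 512–530, §2 (algorithm `Reduce`).
* T. Nipkow, G. Klein, *Concrete Semantics with Isabelle/HOL*, Springer 2014, Ch. 7 (reasoning
  with big-step semantics).
-/

namespace Literature.Computability.FineGrained.Sparsifier

open _root_.Computability Complexity Complexity.ACom

/-! ### The register file -/

/-- The registers of the sparsification program. Input `inp` and output `out` are the input and
output stacks of the final Turing machine; the others are work registers, named after their
main use (several are plain scratch registers). [folklore] -/
inductive K where
  | inp | out | out2 | hdr | hdr2 | raw | wl | wl2 | cur | acc | acc2 | keep | drop | kill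
  | c | c2 | cacc | d | d2 | x | x2 | y | ne | fl | fl2
  | ma | ma2 | mb | mb2 | s | s2 | h | hr | t | cnt | len | found | mask | kid | pt | tmp
  | j1 | j2 | j3 | j4
  deriving DecidableEq, Fintype

/-- Stores of the sparsification program. [folklore] -/
abbrev Store : Type := AStore Γ' K

/-- Programs of the sparsification program. [folklore] -/
abbrev Prog : Type := ACom Γ' K

/-! ### Word encodings -/

/-- Literals `(i, b)`: variable index and polarity, as in `KCNF`. [folklore] -/
abbrev Lit : Type := ℕ × Bool

/-- The body of the encoding of a literal: polarity bit, then the binary digits of the index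
(`KCNF.encodeLiteral l = litBody l ++ [comma]`). [folklore] -/
def litBody (l : Lit) : List Γ' := Γ'.bit l.2 :: (encodeNat l.1).map Γ'.bit

/-- `encodeLiteral` is the body closed by a comma. [folklore] -/
theorem encodeLiteral_eq (l : Lit) : KCNF.encodeLiteral l = litBody l ++ [Γ'.comma] := by
  simp [KCNF.encodeLiteral, litBody]

/-- Every symbol of a literal body is a bit. [folklore] -/
theorem mem_litBody {l : Lit} {a : Γ'} (h : a ∈ litBody l) : ∃ b, a = Γ'.bit b := by
  simp only [litBody, List.mem_cons, List.mem_map] at h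
  rcases h with rfl | ⟨b, -, rfl⟩
  · exact ⟨_, rfl⟩
  · exact ⟨_, rfl⟩

/-- The comma is not a symbol of a literal body. [folklore] -/
theorem comma_not_mem_litBody (l : Lit) : Γ'.comma ∉ litBody l := fun h => by
  obtain ⟨b, hb⟩ := mem_litBody h; cases hb

/-- Literal bodies determine the literal. [folklore] -/
theorem litBody_injective : Function.Injective litBody := by
  intro l₁ l₂ h
  simp only [litBody, List.cons.injEq, Γ'.bit.injEq] at h
  obtain ⟨h2, h1⟩ := h
  have h1' : encodeNat l₁.1 = encodeNat l₂.1 :=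
    List.map_injective_iff.2 (fun a b hab => by simpa using hab) h1
  have : l₁.1 = l₂.1 := by rw [← decode_encodeNat l₁.1, h1', decode_encodeNat]
  exact Prod.ext this h2

/-- The body of a clause: its literals, each closed by a comma
(`KCNF.encodeClause c = bra :: cbody c ++ [ket]`). [folklore] -/
def cbody (c : List Lit) : List Γ' := c.flatMap KCNF.encodeLiteral

/-- Body of the empty clause. [folklore] -/
@[simp] theorem cbody_nil : cbody [] = [] := rfl

/-- Body of `l :: c`. [folklore] -/
theorem cbody_cons (l : Lit) (c : List Lit) :
    cbody (l :: c) = litBody l ++ Γ'.comma :: cbody c := by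
  simp [cbody, encodeLiteral_eq]

/-- Body of a concatenation. [folklore] -/
theorem cbody_append (c d : List Lit) : cbody (c ++ d) = cbody c ++ cbody d := by
  simp [cbody]

/-- `encodeClause` is the body between brackets. [folklore] -/
theorem encodeClause_eq (c : List Lit) : KCNF.encodeClause c = Γ'.bra :: cbody c ++ [Γ'.ket] := by
  simp [KCNF.encodeClause, cbody]

/-- The word of a family of clauses: the encoded clauses in order. [folklore] -/
def wFam (F : List (List Lit)) : List Γ' := F.flatMap KCNF.encodeClause

/-- Word of the empty family. [folklore] -/
@[simp] theorem wFam_nil : wFam [] = [] := rfl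

/-- Word of `c :: F`. [folklore] -/
theorem wFam_cons (c : List Lit) (F : List (List Lit)) :
    wFam (c :: F) = Γ'.bra :: cbody c ++ Γ'.ket :: wFam F := by
  simp [wFam, encodeClause_eq]

/-- Word of a concatenation of families. [folklore] -/
theorem wFam_append (F G : List (List Lit)) : wFam (F ++ G) = wFam F ++ wFam G := by
  simp [wFam]

/-- The word of a work-list of families: each family word closed by a blank. [folklore] -/
def wWL (L : List (List (List Lit))) : List Γ' := L.flatMap fun F => wFam F ++ [Γ'.blank]

/-- Word of the empty work-list. [folklore] -/
@[simp] theorem wWL_nil : wWL [] = [] := rfl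

/-- Word of `F :: L`. [folklore] -/
theorem wWL_cons (F : List (List Lit)) (L : List (List (List Lit))) :
    wWL (F :: L) = wFam F ++ Γ'.blank :: wWL L := by
  simp [wWL]

/-- A flag register: `[blank]` for true, `[]` for false. [folklore] -/
def flag (p : Prop) [Decidable p] : List Γ' := if p then [Γ'.blank] else []

/-- The true flag. [folklore] -/
@[simp] theorem flag_true {p : Prop} [Decidable p] (h : p) : flag p = [Γ'.blank] := if_pos h

/-- The false flag. [folklore] -/
@[simp] theorem flag_false {p : Prop} [Decidable p] (h : ¬ p) : flag p = [] := if_neg h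

/-- A unary counter register. [folklore] -/
def unary (n : ℕ) : List Γ' := List.replicate n Γ'.blank

/-- Length of a unary counter. [folklore] -/
@[simp] theorem length_unary (n : ℕ) : (unary n).length = n := List.length_replicate

/-- Zero. [folklore] -/
@[simp] theorem unary_zero : unary 0 = [] := rfl

/-- Successor. [folklore] -/
theorem unary_succ (n : ℕ) : unary (n + 1) = Γ'.blank :: unary n := rfl

/-! ### Flags -/

/-- `normFlag k`: normalise register `k` to `[blank]` if it is nonempty, `[]` otherwise.
[folklore] -/
def normFlag (k : K) : Prog :=
  pop k fun o => match o with
    | some _ => clear k ;; push k Γ'.blank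
    | none => skip

/-- Effect and cost of `normFlag`. [folklore] -/
theorem runs_normFlag (k : K) (R : Store) :
    Runs (normFlag k) R (Function.update R k (flag (R k ≠ []))) (2 * (R k).length + 4) := by
  unfold normFlag
  cases hk : R k with
  | nil =>
    have h : Runs skip R (Function.update R k (flag (([] : List Γ') ≠ []))) 0 :=
      (Runs.skip R).of_eq (by simp [← hk]) le_rfl
    exact (Runs.pop_nil hk h).mono (by omega)
  | cons a w =>
    have h1 := runs_clear k (Function.update R k w)
    simp only [Function.update_self, Function.update_idem] at h1
    have h2 := Runs.push k Γ'.blank (Function.update R k [])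
    simp only [Function.update_self, Function.update_idem] at h2
    refine (Runs.pop_cons hk (h1.seq h2)).of_eq ?_ (by simp only [List.length_cons]; omega)
    simp [flag]

/-! ### Equality of literals -/

/-- Body of the comparison loop of `eqXY`: save the symbol of `x` on `x2`, pop `y` and record a
mismatch on `ne`. [folklore] -/
def eqBody (a : Γ') : Prog :=
  push K.x2 a ;; pop K.y fun o => if o = some a then skip else push K.ne Γ'.blank

/-- `eqXY`: compare the words held in `x` and `y` (two literal bodies, both reversed — equality
of words does not depend on the orientation); afterwards `x` is restored, `y` is emptied and
`ne` holds the flag "the words differ". Requires `x2 = ne = []`. [folklore] -/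
def eqXY : Prog :=
  loop K.x eqBody ;;
  pop K.y (fun o => match o with
    | some _ => push K.ne Γ'.blank ;; clear K.y
    | none => skip) ;;
  pour K.x2 K.x ;; normFlag K.ne

/-- One mismatch indicator: does position `n` of `v` hold `a`? [folklore] -/
def mis (a : Γ') (v : List Γ') (n : ℕ) : ℕ := if v[n]? = some a then 0 else 1

/-- Number of mismatches recorded after consuming `done` (most recent first) against `v`.
[folklore] -/
def misCount : List Γ' → List Γ' → ℕ
  | [], _ => 0
  | a :: done, v => misCount done v + mis a v done.length

/-- No mismatch was recorded iff the consumed prefix is a prefix of `v`. [folklore] -/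
theorem misCount_eq_zero_iff : ∀ (done v : List Γ'),
    misCount done v = 0 ↔ done.reverse = v.take done.length
  | [], v => by simp [misCount]
  | a :: done, v => by
    rw [misCount, Nat.add_eq_zero_iff, misCount_eq_zero_iff done v, List.reverse_cons,
      List.length_cons, List.take_add_one]
    cases h : v[done.length]? with
    | none =>
      simp only [mis, h, Option.toList_none, List.append_nil]
      constructor
      · rintro ⟨-, h1⟩; simp at h1
      · intro h1
        have := congrArg List.length h1
        simp only [List.length_append, List.length_reverse, List.length_singleton,
          List.length_take] at this
        omega
    | some b =>
      simp only [mis, h, Option.some.injEq, Option.toList_some]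
      constructor
      · rintro ⟨h1, h2⟩
        by_cases hba : b = a
        · rw [h1, hba]
        · simp [hba] at h2
      · intro h1
        obtain ⟨h2, h3⟩ := List.append_inj' h1 rfl
        simp only [List.cons.injEq, and_true] at h3
        exact ⟨h2, by simp [h3]⟩

/-- The final mismatch count of `eqXY` vanishes iff the words are equal. [folklore] -/
theorem misCount_final_eq_zero_iff (u v : List Γ') :
    misCount u.reverse v + (if u.length < v.length then 1 else 0) = 0 ↔ u = v := by
  rw [Nat.add_eq_zero_iff, misCount_eq_zero_iff, List.reverse_reverse, List.length_reverse]
  constructor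
  · rintro ⟨h1, h2⟩
    have hlen : v.length ≤ u.length := by
      by_contra h; rw [if_pos (Nat.lt_of_not_le h)] at h2; exact absurd h2 one_ne_zero
    rw [h1, List.take_of_length_le hlen]
  · rintro rfl
    simp

/-- **Specification of `eqXY`.** With `x2 = ne = []`, `eqXY` leaves `x` unchanged, empties `y`,
and sets `ne` to the flag `x ≠ y`, within `12 · (|x| + |y|) + 12` steps. [folklore] -/
theorem runs_eqXY (R : Store) (hx2 : R K.x2 = []) (hne : R K.ne = []) :
    Runs eqXY R (Function.update (Function.update R K.y []) K.ne (flag (R K.x ≠ R K.y)))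
      (12 * ((R K.x).length + (R K.y).length) + 12) := by
  set u := R K.x with hu
  set v := R K.y with hv
  unfold eqXY
  -- the store during the comparison loop
  set S : List Γ' → List Γ' → Store := fun done rest =>
    Function.update (Function.update (Function.update (Function.update R K.x rest) K.x2 done)
      K.y (v.drop done.length)) K.ne (unary (misCount done v)) with hS
  have hS0 : S [] u = R := by
    funext r; cases r <;> simp [hS, hu, hv, hx2, hne, misCount]
  have hloop := runs_loop_inv (k := K.x) (f := eqBody) S (fun _ _ => True) 4
    (fun done rest _ => by simp [hS])
    (fun done a rest _ => ⟨trivial, by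
      unfold eqBody
      set T1 : Store := Function.update (Function.update (S done (a :: rest)) K.x rest) K.x2
        (a :: Function.update (S done (a :: rest)) K.x rest K.x2) with hT1
      have h1 : Runs (push K.x2 a) (Function.update (S done (a :: rest)) K.x rest) T1 1 :=
        Runs.push K.x2 a _
      have hT1y : T1 K.y = v.drop done.length := by simp [hT1, hS]
      cases hd : v.drop done.length with
      | nil =>
        have hn : v[done.length]? = none := by rw [← List.head?_drop, hd]; rfl
        have hd' : v.drop (done.length + 1) = [] := by rw [← List.tail_drop, hd]; rfl
        have h2 : Runs (push K.ne Γ'.blank) T1 (S (a :: done) rest) 1 := by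
          refine Runs.push' ?_
          simp only [hT1, hS, misCount, mis, hn, List.length_cons, hd']
          funext r; cases r <;> simp [hd, unary_succ]
        have hk : T1 K.y = [] := by rw [hT1y, hd]
        have h3 := Runs.pop_nil (f := fun o => if o = some a then skip else push K.ne Γ'.blank)
          hk (by rw [if_neg (by simp)]; exact h2)
        exact (h1.seq h3).mono (by norm_num)
      | cons b w =>
        have hb : v[done.length]? = some b := by rw [← List.head?_drop, hd]; rfl
        have hw : v.drop (done.length + 1) = w := by rw [← List.tail_drop, hd]; rfl
        have hk : T1 K.y = b :: w := by rw [hT1y, hd]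
        by_cases hba : b = a
        · subst hba
          have h2 : Runs skip (Function.update T1 K.y w) (S (b :: done) rest) 0 := by
            refine (Runs.skip _).of_eq ?_ le_rfl
            simp only [hT1, hS, misCount, mis, hb, List.length_cons, hw]
            funext r; cases r <;> simp
          have h3 := Runs.pop_cons (f := fun o => if o = some b then skip else push K.ne Γ'.blank)
            hk (by rw [if_pos rfl]; exact h2)
          exact (h1.seq h3).mono (by norm_num)
        · have h2 : Runs (push K.ne Γ'.blank) (Function.update T1 K.y w) (S (a :: done) rest)
              1 := by
            refine Runs.push' ?_
            simp only [hT1, hS, misCount, mis, hb, List.length_cons, hw, Option.some.injEq,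
              if_neg hba]
            funext r; cases r <;> simp [unary_succ]
          have h3 := Runs.pop_cons (f := fun o => if o = some a then skip else push K.ne Γ'.blank)
            hk (by rw [if_neg (by simpa using hba)]; exact h2)
          exact (h1.seq h3).mono (by norm_num)⟩)
    u [] trivial
  rw [hS0] at hloop
  simp only [List.append_nil] at hloop
  -- the length check on `y`
  set N := misCount u.reverse v + (if u.length < v.length then 1 else 0) with hN
  set T2 : Store := Function.update (Function.update (S u.reverse []) K.y []) K.ne (unary N)
    with hT2
  have hstep2 : Runs (pop K.y (fun o => match o with
      | some _ => push K.ne Γ'.blank ;; clear K.y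
      | none => skip)) (S u.reverse []) T2 (2 * v.length + 4) := by
    cases hd : v.drop u.length with
    | nil =>
      have hle : v.length ≤ u.length := by
        have := congrArg List.length hd
        simp only [List.length_drop, List.length_nil] at this
        omega
      have hk : S u.reverse [] K.y = [] := by simp [hS, hd]
      have h2 : Runs skip (S u.reverse []) T2 0 := by
        refine (Runs.skip _).of_eq ?_ le_rfl
        rw [hT2, hN, if_neg (Nat.not_lt.2 hle), Nat.add_zero]
        simp only [hS, List.length_reverse]
        funext r; cases r <;> simp [hd]
      exact (Runs.pop_nil hk h2).mono (by omega)
    | cons b w =>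
      have hlt : u.length < v.length := by
        by_contra h
        rw [List.drop_eq_nil_of_le (Nat.le_of_not_lt h)] at hd
        cases hd
      have hwlen : w.length ≤ v.length := by
        have := congrArg List.length hd
        simp only [List.length_drop, List.length_cons] at this
        omega
      have hk : S u.reverse [] K.y = b :: w := by simp [hS, hd]
      set T3 : Store := Function.update (S u.reverse []) K.y w with hT3
      have h2 : Runs (push K.ne Γ'.blank) T3 (Function.update T3 K.ne (Γ'.blank :: T3 K.ne)) 1 :=
        Runs.push K.ne Γ'.blank T3
      have h3 := runs_clear K.y (Function.update T3 K.ne (Γ'.blank :: T3 K.ne))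
      have h3w : (Function.update T3 K.ne (Γ'.blank :: T3 K.ne) K.y).length = w.length := by
        simp [hT3]
      rw [h3w] at h3
      have h23 := (h2.seq h3).of_eq (R' := T2) (B := 2 * v.length + 2) (by
        rw [hT2, hN, if_pos hlt, hT3]
        simp only [hS, List.length_reverse, unary_succ]
        funext r; cases r <;> simp) (by omega)
      exact (Runs.pop_cons hk h23).mono (by omega)
  have hstep3 := runs_pour (a := K.x2) (b := K.x) (by decide) T2
  set T4 : Store := Function.update (Function.update T2 K.x2 []) K.x ((T2 K.x2).reverse ++ T2 K.x)
    with hT4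
  have hstep4 := runs_normFlag K.ne T4
  have hx2len : (T2 K.x2).length = u.length := by simp [hT2, hS]
  have hnelen : (T4 K.ne).length ≤ u.length + 1 := by
    have h1 : (T4 K.ne).length = N := by simp [hT4, hT2]
    have h2 : misCount u.reverse v ≤ u.reverse.length := by
      generalize u.reverse = d
      induction d with
      | nil => simp [misCount]
      | cons a d ih => simp only [misCount, mis, List.length_cons]; split <;> omega
    rw [h1, hN]
    rw [List.length_reverse] at h2
    split <;> omega
  rw [hx2len] at hstep3
  have := hloop.seq (hstep2.seq (hstep3.seq hstep4))
  refine this.of_eq ?_ ?_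
  · have hflag : flag (T4 K.ne ≠ []) = flag (u ≠ v) := by
      have h1 : T4 K.ne = unary N := by simp [hT4, hT2]
      simp only [flag, h1, ne_eq, ← List.length_eq_zero_iff, length_unary, hN,
        misCount_final_eq_zero_iff]
    rw [hflag, hT4, hT2]
    simp only [hS]
    funext r; cases r <;> simp [hu, hx2]
  · have : 2 * (T4 K.ne).length + 4 ≤ 2 * u.length + 6 := by omega
    nlinarith [this]

/-- Literal bodies determine the literal (iff form). [folklore] -/
@[simp] theorem litBody_inj {l l' : Lit} : litBody l = litBody l' ↔ l = l' :=
  litBody_injective.eq_iff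

/-- `unary n` followed by a blank. [folklore] -/
theorem unary_append_blank (n : ℕ) (w : List Γ') :
    unary n ++ Γ'.blank :: w = unary (n + 1) ++ w := by
  simp [unary, List.replicate_succ']

/-! ### Membership of a literal in a clause -/

/-- Body of the membership loop: save the symbol of `c` on `c2`; accumulate the current literal
(reversed) in `y`; at its closing comma compare it with `x` and record a hit on `fl`.
[folklore] -/
def memBody (a : Γ') : Prog :=
  push K.c2 a ;;
  match a with
  | Γ'.comma => eqXY ;; pop K.ne fun o => match o with
    | some _ => skip
    | none => push K.fl Γ'.blank
  | _ => push K.y a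

/-- `memXC`: with the literal `l` held reversed in `x` and a clause body `cbody cl` in `c`,
decide `l ∈ cl` into the flag register `fl`; `x` and `c` are preserved. Requires
`c2 = y = x2 = ne = fl = []`. [folklore] -/
def memXC : Prog := loop K.c memBody ;; pour K.c2 K.c ;; normFlag K.fl

/-- The accumulation segment of `memBody` over comma-free symbols. [folklore] -/
theorem segRuns_memBody_bits : ∀ (bs : List Γ') (_ : Γ'.comma ∉ bs) (T : Store) (v : List Γ')
    (_ : T K.c = bs ++ v),
    SegRuns K.c memBody bs T
      (Function.update (Function.update (Function.update T K.c v) K.c2 (bs.reverse ++ T K.c2))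
        K.y (bs.reverse ++ T K.y)) (4 * bs.length)
  | [], _, T, v, hc => by
    refine (SegRuns.nil K.c memBody T).of_eq ?_ (by simp)
    rw [List.nil_append] at hc
    simp [← hc]
  | a :: bs, hbs, T, v, hc => by
    have ha : a ≠ Γ'.comma := fun h => hbs (h ▸ List.mem_cons_self)
    have hbs' : Γ'.comma ∉ bs := fun h => hbs (List.mem_cons_of_mem _ h)
    set T₁ : Store := Function.update (Function.update (Function.update T K.c (bs ++ v)) K.c2
      (a :: T K.c2)) K.y (a :: T K.y) with hT₁
    have hbody : Runs (memBody a) (Function.update T K.c (bs ++ v)) T₁ 2 := by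
      have h1 := Runs.push K.c2 a (Function.update T K.c (bs ++ v))
      have h2 := Runs.push K.y a
        (Function.update (Function.update T K.c (bs ++ v)) K.c2
          (a :: Function.update T K.c (bs ++ v) K.c2))
      have h12 := h1.seq h2
      have e : (push K.c2 a ;; push K.y a : Prog) = memBody a := by
        cases a with
        | comma => exact absurd rfl ha
        | _ => rfl
      rw [e] at h12
      refine h12.of_eq ?_ (by norm_num)
      simp only [hT₁]
      funext r; cases r <;> simp
    have ih := segRuns_memBody_bits bs hbs' T₁ v (by simp [hT₁])
    refine (SegRuns.cons hc hbody ih).of_eq ?_ (by simp; omega)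
    simp only [hT₁]
    funext r; cases r <;> simp

/-- **The membership loop**: over `c = cbody cl` it moves the clause body (reversed) onto `c2`
and pushes one blank on `fl` per occurrence of the literal of `x` in `cl`. [folklore] -/
theorem runs_loop_memBody (l : Lit) (L : ℕ) (hl : (litBody l).length ≤ L) :
    ∀ (cl : List Lit) (T : Store), T K.c = cbody cl → T K.y = [] → T K.x2 = [] → T K.ne = [] →
      T K.x = (litBody l).reverse → (∀ l' ∈ cl, (litBody l').length ≤ L) →
      Runs (loop K.c memBody) T
        (Function.update (Function.update (Function.update T K.c []) K.c2
          ((cbody cl).reverse ++ T K.c2)) K.fl (unary (cl.count l) ++ T K.fl))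
        (30 * (L + 1) * cl.length + 1)
  | [], T, hc, hy, hx2, hne, hx, hL => by
    rw [cbody_nil] at hc
    refine (Runs.loop_nil memBody (R := T) hc).of_eq ?_ (by simp)
    funext r; cases r <;> simp [hc]
  | l' :: cl, T, hc, hy, hx2, hne, hx, hL => by
    rw [cbody_cons] at hc
    -- segment over the body of `l'`
    have hseg := segRuns_memBody_bits (litBody l') (comma_not_mem_litBody l') T
      (Γ'.comma :: cbody cl) hc
    rw [hy, List.append_nil] at hseg
    set T₁ : Store := Function.update (Function.update (Function.update T K.c
      (Γ'.comma :: cbody cl)) K.c2 ((litBody l').reverse ++ T K.c2)) K.y (litBody l').reverse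
      with hT₁
    -- the comma step
    set T₂ : Store := Function.update (Function.update T₁ K.c (cbody cl)) K.c2
      (Γ'.comma :: T₁ K.c2) with hT₂
    have hpush : Runs (push K.c2 Γ'.comma) (Function.update T₁ K.c (cbody cl)) T₂ 1 :=
      Runs.push' (by simp [hT₂, hT₁])
    have heq := runs_eqXY T₂ (by simp [hT₂, hT₁, hx2]) (by simp [hT₂, hT₁, hne])
    have hT₂x : T₂ K.x = (litBody l).reverse := by simp [hT₂, hT₁, hx]
    have hT₂y : T₂ K.y = (litBody l').reverse := by simp [hT₂, hT₁]
    rw [hT₂x, hT₂y, List.length_reverse, List.length_reverse] at heq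
    set T₃ : Store := Function.update (Function.update T₂ K.y []) K.ne
      (flag ((litBody l).reverse ≠ (litBody l').reverse)) with hT₃
    set T₄ : Store := Function.update (Function.update T₃ K.ne []) K.fl
      ((if l' = l then [Γ'.blank] else []) ++ T K.fl) with hT₄
    have hpop : Runs (pop K.ne fun o => match o with
        | some _ => skip
        | none => push K.fl Γ'.blank) T₃ T₄ 3 := by
      by_cases hll : l' = l
      · have hk : T₃ K.ne = [] := by
          simp [hT₃, flag, hll]
        refine (Runs.pop_nil hk (Runs.push' ?_)).mono (by norm_num)
        rw [hT₄, if_pos hll]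
        funext r; cases r <;> simp [hT₃, hT₂, hT₁, hll]
      · have hk : T₃ K.ne = [Γ'.blank] := by
          simp [hT₃, flag, Ne.symm hll]
        refine (Runs.pop_cons hk ((Runs.skip _).of_eq ?_ le_rfl)).mono (by norm_num)
        rw [hT₄, if_neg hll]
        funext r; cases r <;> simp [hT₃, hT₂, hT₁, Ne.symm hll]
    have hcomma : Runs (memBody Γ'.comma) (Function.update T₁ K.c (cbody cl)) T₄
        (24 * L + 16) := by
      have := hpush.seq (heq.seq hpop)
      refine this.mono ?_
      have h1 := hL l' List.mem_cons_self
      nlinarith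
    -- the rest of the clause
    have hL' : ∀ l'' ∈ cl, (litBody l'').length ≤ L := fun l'' h =>
      hL l'' (List.mem_cons_of_mem _ h)
    have ih := runs_loop_memBody l L hl cl T₄ (by simp [hT₄, hT₃, hT₂, hT₁])
      (by simp [hT₄, hT₃]) (by simp [hT₄, hT₃, hT₂, hT₁, hx2]) (by simp [hT₄])
      (by simp [hT₄, hT₃, hT₂, hT₁, hx]) hL'
    have hstep := SegRuns.single (f := memBody) (by simp [hT₁] : T₁ K.c = Γ'.comma :: cbody cl)
      hcomma
    have := (hseg.append hstep).runs_loop ih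
    refine this.of_eq ?_ ?_
    · simp only [hT₄, hT₃, hT₂, hT₁]
      by_cases hll : l' = l
      · funext r; cases r <;> simp [hne, hy, hll, cbody_cons, unary_append_blank]
      · funext r; cases r <;> simp [hne, hy, hll, cbody_cons]
    · have h1 := hL l' List.mem_cons_self
      simp only [List.length_cons]
      nlinarith

/-- **Specification of `memXC`.** With `x = (litBody l).reverse`, `c = cbody cl` and the
scratch registers `c2, y, x2, ne, fl` empty, `memXC` preserves `x` and `c` and sets `fl` to the
flag `l ∈ cl`, within `36 (L + 1) |cl| + 6` steps, `L` bounding the literal lengths.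
[folklore] -/
theorem runs_memXC (l : Lit) (cl : List Lit) (L : ℕ) (hl : (litBody l).length ≤ L)
    (hL : ∀ l' ∈ cl, (litBody l').length ≤ L) (T : Store) (hc : T K.c = cbody cl)
    (hx : T K.x = (litBody l).reverse) (hc2 : T K.c2 = []) (hy : T K.y = []) (hx2 : T K.x2 = [])
    (hne : T K.ne = []) (hfl : T K.fl = []) :
    Runs memXC T (Function.update T K.fl (flag (l ∈ cl))) (36 * (L + 1) * cl.length + 6) := by
  unfold memXC
  have h1 := runs_loop_memBody l L hl cl T hc hy hx2 hne hx hL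
  rw [hc2, hfl, List.append_nil, List.append_nil] at h1
  set T₁ : Store := Function.update (Function.update (Function.update T K.c []) K.c2
    (cbody cl).reverse) K.fl (unary (cl.count l)) with hT₁
  have h2 := runs_pour (a := K.c2) (b := K.c) (by decide) T₁
  have hT₁c2 : T₁ K.c2 = (cbody cl).reverse := by simp [hT₁]
  have hT₁c : T₁ K.c = [] := by simp [hT₁]
  rw [hT₁c2, hT₁c, List.length_reverse, List.reverse_reverse, List.append_nil] at h2
  set T₂ : Store := Function.update (Function.update T₁ K.c2 []) K.c (cbody cl) with hT₂
  have h3 := runs_normFlag K.fl T₂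
  have hT₂fl : T₂ K.fl = unary (cl.count l) := by simp [hT₂, hT₁]
  rw [hT₂fl, length_unary] at h3
  have := h1.seq (h2.seq h3)
  refine this.of_eq ?_ ?_
  · have hflag : flag (unary (cl.count l) ≠ []) = flag (l ∈ cl) := by
      simp only [flag, ne_eq, ← List.length_eq_zero_iff, length_unary,
        List.count_eq_zero, not_not]
    rw [hflag, hT₂, hT₁]
    funext r; cases r <;> simp [hc, hc2]
  · have hlen : (cbody cl).length ≤ (L + 1) * cl.length := by
      clear h1 h2 h3 this hc hT₁ hT₂ T₁ T₂ hT₁c2 hT₁c hT₂fl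
      induction cl with
      | nil => simp
      | cons a cl ih =>
        have h1 := hL a List.mem_cons_self
        have h2 := ih (fun l' h => hL l' (List.mem_cons_of_mem _ h))
        simp only [cbody_cons, List.length_append, List.length_cons]
        nlinarith
    have hcount : cl.count l ≤ cl.length := List.count_le_length
    nlinarith

/-! ### Generic pass over a clause body, literal by literal -/

/-- Body of a generic pass over a clause body held in some register: save the symbol on `sv`,
accumulate the current literal (reversed) on `ac`, and at its closing comma run `act`.
[folklore] -/
def litPass (sv ac : K) (act : Prog) (a : Γ') : Prog :=
  push sv a ;;
  match a with
  | Γ'.comma => act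
  | _ => push ac a

/-- The accumulation segment of `litPass` over comma-free symbols. [folklore] -/
theorem segRuns_litPass_bits {reg sv ac : K} (act : Prog) (h1 : reg ≠ sv) (h2 : reg ≠ ac)
    (h3 : sv ≠ ac) : ∀ (bs : List Γ') (_ : Γ'.comma ∉ bs) (T : Store) (v : List Γ')
    (_ : T reg = bs ++ v),
    SegRuns reg (litPass sv ac act) bs T
      (Function.update (Function.update (Function.update T reg v) sv (bs.reverse ++ T sv))
        ac (bs.reverse ++ T ac)) (4 * bs.length)
  | [], _, T, v, hc => by
    refine (SegRuns.nil reg _ T).of_eq ?_ (by simp)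
    rw [List.nil_append] at hc
    simp [← hc]
  | a :: bs, hbs, T, v, hc => by
    have ha : a ≠ Γ'.comma := fun h => hbs (h ▸ List.mem_cons_self)
    have hbs' : Γ'.comma ∉ bs := fun h => hbs (List.mem_cons_of_mem _ h)
    set T₁ : Store := Function.update (Function.update (Function.update T reg (bs ++ v)) sv
      (a :: T sv)) ac (a :: T ac) with hT₁
    have hbody : Runs (litPass sv ac act a) (Function.update T reg (bs ++ v)) T₁ 2 := by
      have e1 := Runs.push sv a (Function.update T reg (bs ++ v))
      have e2 := Runs.push ac a
        (Function.update (Function.update T reg (bs ++ v)) sv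
          (a :: Function.update T reg (bs ++ v) sv))
      have e12 := e1.seq e2
      have e : (push sv a ;; push ac a : Prog) = litPass sv ac act a := by
        cases a with
        | comma => exact absurd rfl ha
        | _ => rfl
      rw [e] at e12
      refine e12.of_eq ?_ (by norm_num)
      simp only [hT₁]
      funext r
      rcases eq_or_ne sv r with rfl | hsv
      · simp [Function.update_of_ne h3, Function.update_of_ne h1.symm]
      · rcases eq_or_ne ac r with rfl | hac
        · simp [Function.update_of_ne h3.symm, Function.update_of_ne h2.symm]
        · simp [Function.update_of_ne hsv.symm, Function.update_of_ne hac.symm]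
    have ih := segRuns_litPass_bits act h1 h2 h3 bs hbs' T₁ v (by
      simp [hT₁, Function.update_of_ne h2, Function.update_of_ne h1])
    refine (SegRuns.cons hc hbody ih).of_eq ?_ (by simp; omega)
    simp only [hT₁]
    funext r
    rcases eq_or_ne reg r with rfl | hrg
    · simp [Function.update_of_ne h2, Function.update_of_ne h1]
    · rcases eq_or_ne sv r with rfl | hsv
      · simp [Function.update_of_ne h3]
      · rcases eq_or_ne ac r with rfl | hac
        · simp
        · simp [Function.update_of_ne hsv.symm, Function.update_of_ne hac.symm,
            Function.update_of_ne hrg.symm]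

/-- The store just before the action of `litPass`: the literal `l` has been consumed from `reg`
(with its comma), saved reversed on `sv`, and accumulated reversed on `ac`. [folklore] -/
def litPre (reg sv ac : K) (S : Store) (l : Lit) (rest : List Lit) : Store :=
  Function.update (Function.update (Function.update S reg (cbody rest)) sv
    ((litBody l ++ [Γ'.comma]).reverse ++ S sv)) ac ((litBody l).reverse ++ S ac)

/-- **Generic clause-body pass.** Let `St done rest` describe the store at the literal boundary
after the literals `done` (in order) have been processed and `rest` remain in `reg`, with
`ac` empty there. If the action leads from `litPre reg sv ac (St done (l :: rest)) l rest` to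
`St (done ++ [l]) rest` within `B`, then the pass leads from `St done rest` to
`St (done ++ rest) []` within `(4 L + B + 3) |rest| + 1`, `L` bounding the literal lengths.
[folklore] -/
theorem runs_litPass {reg sv ac : K} (act : Prog) (h1 : reg ≠ sv) (h2 : reg ≠ ac)
    (h3 : sv ≠ ac) (St : List Lit → List Lit → Store) (full : List Lit) (L B : ℕ)
    (hreg : ∀ done rest, St done rest reg = cbody rest)
    (hacc : ∀ done rest, St done rest ac = [])
    (hact : ∀ done l rest, done ++ l :: rest = full → (litBody l).length ≤ L →
      Runs act (litPre reg sv ac (St done (l :: rest)) l rest) (St (done ++ [l]) rest) B) :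
    ∀ (rest done : List Lit), done ++ rest = full → (∀ l ∈ rest, (litBody l).length ≤ L) →
      Runs (loop reg (litPass sv ac act)) (St done rest) (St (done ++ rest) [])
        ((4 * L + B + 3) * rest.length + 1)
  | [], done, _, _ => by
    simpa using Runs.loop_nil (litPass sv ac act) (R := St done []) (by simpa using hreg done [])
  | l :: rest, done, hfull, hL => by
    have hl := hL l List.mem_cons_self
    have hc : St done (l :: rest) reg = litBody l ++ Γ'.comma :: cbody rest := by
      rw [hreg, cbody_cons]
    have hseg := segRuns_litPass_bits act h1 h2 h3 (litBody l) (comma_not_mem_litBody l)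
      (St done (l :: rest)) (Γ'.comma :: cbody rest) hc
    set T₁ : Store := Function.update (Function.update (Function.update (St done (l :: rest)) reg
      (Γ'.comma :: cbody rest)) sv ((litBody l).reverse ++ St done (l :: rest) sv)) ac
      ((litBody l).reverse ++ St done (l :: rest) ac) with hT₁
    have hT₁reg : T₁ reg = Γ'.comma :: cbody rest := by
      simp [hT₁, Function.update_of_ne h2, Function.update_of_ne h1]
    have hpush : Runs (push sv Γ'.comma) (Function.update T₁ reg (cbody rest))
        (litPre reg sv ac (St done (l :: rest)) l rest) 1 := by
      refine Runs.push' ?_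
      simp only [litPre, hT₁]
      funext r
      rcases eq_or_ne reg r with rfl | hrg
      · simp [Function.update_of_ne h1, Function.update_of_ne h2]
      · rcases eq_or_ne sv r with rfl | hsv
        · simp [Function.update_of_ne h3, Function.update_of_ne h1.symm]
        · rcases eq_or_ne ac r with rfl | hac
          · simp [Function.update_of_ne h2.symm, Function.update_of_ne h3.symm]
          · simp [Function.update_of_ne hsv.symm, Function.update_of_ne hac.symm,
              Function.update_of_ne hrg.symm]
    have hcomma : Runs (litPass sv ac act Γ'.comma) (Function.update T₁ reg (cbody rest))
        (St (done ++ [l]) rest) (1 + B) :=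
      hpush.seq (hact done l rest hfull hl)
    have hstep := SegRuns.single (f := litPass sv ac act) hT₁reg hcomma
    have ih := runs_litPass act h1 h2 h3 St full L B hreg hacc hact rest (done ++ [l])
      (by rw [List.append_assoc]; exact hfull) (fun l' h => hL l' (List.mem_cons_of_mem _ h))
    rw [List.append_assoc, List.singleton_append] at ih
    have := (hseg.append hstep).runs_loop ih
    refine this.mono ?_
    simp only [List.length_cons]
    nlinarith

/-! ### Inclusion of clauses -/

/-- Body of the inclusion loop: a `litPass` over `d` whose action tests membership of the
accumulated literal in the clause body of `c` and records a miss on `fl2`. [folklore] -/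
def subAct : Prog :=
  memXC ;; pop K.fl (fun o => match o with
    | some _ => skip
    | none => push K.fl2 Γ'.blank) ;; clear K.x

/-- `subDC`: with clause bodies `cbody dl` in `d` and `cbody cl` in `c`, decide `¬ dl ⊆ cl`
into the flag register `fl2`; `d` and `c` are preserved. Requires
`x = d2 = fl2 = c2 = y = x2 = ne = fl = []`. [folklore] -/
def subDC : Prog := loop K.d (litPass K.d2 K.x subAct) ;; pour K.d2 K.d ;; normFlag K.fl2

/-- The store of `subDC` at a literal boundary. [folklore] -/
def subSt (T : Store) (cl : List Lit) (done rest : List Lit) : Store :=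
  Function.update (Function.update (Function.update T K.d (cbody rest)) K.d2
    ((cbody done).reverse ++ T K.d2)) K.fl2 (unary (done.countP fun l => l ∉ cl) ++ T K.fl2)

/-- **Specification of `subDC`.** [folklore] -/
theorem runs_subDC (dl cl : List Lit) (L : ℕ) (hLd : ∀ l ∈ dl, (litBody l).length ≤ L)
    (hLc : ∀ l ∈ cl, (litBody l).length ≤ L) (T : Store) (hd : T K.d = cbody dl)
    (hc : T K.c = cbody cl) (hx : T K.x = []) (hd2 : T K.d2 = []) (hfl2 : T K.fl2 = [])
    (hc2 : T K.c2 = []) (hy : T K.y = []) (hx2 : T K.x2 = []) (hne : T K.ne = [])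
    (hfl : T K.fl = []) :
    Runs subDC T (Function.update T K.fl2 (flag (¬ dl ⊆ cl)))
      (42 * (L + 1) * (cl.length + 1) * dl.length + 6) := by
  unfold subDC
  have hloop := runs_litPass (reg := K.d) (sv := K.d2) (ac := K.x) subAct (by decide)
    (by decide) (by decide) (subSt T cl) dl L (36 * (L + 1) * cl.length + 2 * L + 10)
    (fun done rest => by simp [subSt])
    (fun done rest => by simp [subSt, hx])
    (fun done l rest _ hl => by
      unfold subAct
      set P := litPre K.d K.d2 K.x (subSt T cl done (l :: rest)) l rest with hP
      have hmem := runs_memXC l cl L hl hLc P (by simp [hP, litPre, subSt, hc])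
        (by simp [hP, litPre, subSt, hx]) (by simp [hP, litPre, subSt, hc2])
        (by simp [hP, litPre, subSt, hy]) (by simp [hP, litPre, subSt, hx2])
        (by simp [hP, litPre, subSt, hne]) (by simp [hP, litPre, subSt, hfl])
      set P₁ := Function.update P K.fl (flag (l ∈ cl)) with hP₁
      set P₂ := Function.update (Function.update P₁ K.fl []) K.fl2
        ((if l ∈ cl then [] else [Γ'.blank]) ++ P K.fl2) with hP₂
      have hpop : Runs (pop K.fl fun o => match o with
          | some _ => skip
          | none => push K.fl2 Γ'.blank) P₁ P₂ 3 := by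
        by_cases hlc : l ∈ cl
        · have hk : P₁ K.fl = [Γ'.blank] := by simp [hP₁, flag, hlc]
          refine (Runs.pop_cons hk ((Runs.skip _).of_eq ?_ le_rfl)).mono (by norm_num)
          rw [hP₂, if_pos hlc]
          funext r; cases r <;> simp [hP₁]
        · have hk : P₁ K.fl = [] := by simp [hP₁, flag, hlc]
          refine (Runs.pop_nil hk (Runs.push' ?_)).mono (by norm_num)
          rw [hP₂, if_neg hlc]
          funext r; cases r <;> simp [hP₁, flag, hlc]
      have hclr := runs_clear K.x P₂
      have hP₂x : P₂ K.x = (litBody l).reverse := by simp [hP₂, hP₁, hP, litPre, subSt, hx]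
      rw [hP₂x, List.length_reverse] at hclr
      have := hmem.seq (hpop.seq hclr)
      refine this.of_eq ?_ (by nlinarith)
      rw [hP₂, hP₁, hP]
      simp only [litPre, subSt]
      by_cases hlc : l ∈ cl
      · funext r; cases r <;> simp [hlc, hx, hfl, cbody_append, cbody_cons, List.countP_append]
      · funext r; cases r <;>
          simp [hlc, hx, hfl, cbody_append, cbody_cons, List.countP_append, unary_succ])
    dl [] rfl hLd
  have hSt0 : subSt T cl [] dl = T := by
    funext r; cases r <;> simp [subSt, hd, hd2, hfl2]
  rw [hSt0, List.nil_append] at hloop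
  set T₁ := subSt T cl dl [] with hT₁
  have hpour := runs_pour (a := K.d2) (b := K.d) (by decide) T₁
  have hT₁d2 : T₁ K.d2 = (cbody dl).reverse := by simp [hT₁, subSt, hd2]
  have hT₁d : T₁ K.d = [] := by simp [hT₁, subSt]
  rw [hT₁d2, hT₁d, List.length_reverse, List.reverse_reverse, List.append_nil] at hpour
  set T₂ := Function.update (Function.update T₁ K.d2 []) K.d (cbody dl) with hT₂
  have hnorm := runs_normFlag K.fl2 T₂
  have hT₂fl2 : T₂ K.fl2 = unary (dl.countP fun l => l ∉ cl) := by simp [hT₂, hT₁, subSt, hfl2]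
  rw [hT₂fl2, length_unary] at hnorm
  have := hloop.seq (hpour.seq hnorm)
  refine this.of_eq ?_ ?_
  · have hflag : flag (unary (dl.countP fun l => l ∉ cl) ≠ []) = flag (¬ dl ⊆ cl) := by
      simp only [flag, ne_eq, ← List.length_eq_zero_iff, length_unary, List.countP_eq_zero,
        decide_eq_true_eq, not_not, List.subset_def]
    rw [hflag, hT₂, hT₁]
    funext r; cases r <;> simp [subSt, hd, hd2, hfl2]
  · have hlen : (cbody dl).length ≤ (L + 1) * dl.length := by
      clear hloop hpour hnorm this hd hSt0 hT₁ hT₂ T₁ T₂ hT₁d2 hT₁d hT₂fl2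
      induction dl with
      | nil => simp
      | cons a dl ih =>
        have e1 := hLd a List.mem_cons_self
        have e2 := ih (fun l' h => hLd l' (List.mem_cons_of_mem _ h))
        simp only [cbody_cons, List.length_append, List.length_cons]
        nlinarith
    have hcount : (dl.countP fun l => l ∉ cl) ≤ dl.length := List.countP_le_length
    nlinarith

/-! ### Generic register utilities over the program's register file -/

/-- `copyFwd a b t₁ t₂`: copy register `a` onto register `b` in the same orientation (through
two scratch registers), keeping `a`. [folklore] -/
def copyFwd (a b t₁ t₂ : K) : Prog := copy2 a t₁ t₂ ;; pour t₁ a ;; pour t₂ b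

/-- Effect and cost of `copyFwd` (scratch registers empty, and `a` is restored). [folklore] -/
theorem runs_copyFwd {a b t₁ t₂ : K} (hab : a ≠ b) (ha1 : a ≠ t₁) (ha2 : a ≠ t₂) (hb1 : b ≠ t₁)
    (hb2 : b ≠ t₂) (h12 : t₁ ≠ t₂) (R : Store) (h1 : R t₁ = []) (h2 : R t₂ = []) :
    Runs (copyFwd a b t₁ t₂) R (Function.update R b (R a ++ R b)) (10 * (R a).length + 3) := by
  unfold copyFwd
  have e1 := runs_copy2 (a := a) (b := t₁) (c := t₂) ha1 ha2 h12 R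
  simp only [h1, h2, List.append_nil] at e1
  set R₁ := Function.update (Function.update (Function.update R a []) t₁ (R a).reverse) t₂
    (R a).reverse with hR₁
  have e2 := runs_pour (a := t₁) (b := a) ha1.symm R₁
  have hR₁t1 : R₁ t₁ = (R a).reverse := by simp [hR₁, Function.update_of_ne h12]
  have hR₁a : R₁ a = [] := by
    simp [hR₁, Function.update_of_ne ha2, Function.update_of_ne ha1]
  rw [hR₁t1, hR₁a, List.length_reverse, List.reverse_reverse, List.append_nil] at e2
  set R₂ := Function.update (Function.update R₁ t₁ []) a (R a) with hR₂
  have e3 := runs_pour (a := t₂) (b := b) hb2.symm R₂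
  have hR₂t2 : R₂ t₂ = (R a).reverse := by
    simp [hR₂, hR₁, Function.update_of_ne ha2.symm, Function.update_of_ne h12.symm]
  have hR₂b : R₂ b = R b := by
    simp [hR₂, hR₁, Function.update_of_ne hab.symm, Function.update_of_ne hb1,
      Function.update_of_ne hb2]
  rw [hR₂t2, hR₂b, List.length_reverse, List.reverse_reverse] at e3
  refine (e1.seq (e2.seq e3)).of_eq ?_ (by omega)
  rw [hR₂, hR₁]
  funext r
  rcases eq_or_ne a r with rfl | hra
  · simp [Function.update_of_ne hab, Function.update_of_ne ha2]
  · rcases eq_or_ne b r with rfl | hrb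
    · simp
    · rcases eq_or_ne t₁ r with rfl | hr1
      · simp [Function.update_of_ne hb1.symm, Function.update_of_ne h12,
          Function.update_of_ne ha1.symm, h1]
      · rcases eq_or_ne t₂ r with rfl | hr2
        · simp [Function.update_of_ne hb2.symm, h2]
        · simp [Function.update_of_ne hra.symm, Function.update_of_ne hrb.symm,
            Function.update_of_ne hr1.symm, Function.update_of_ne hr2.symm]

/-- `swap a b t₁ t₂`: exchange the contents of registers `a` and `b`, keeping orientations
(through two scratch registers). [folklore] -/
def swap (a b t₁ t₂ : K) : Prog := pour a t₁ ;; pour b t₂ ;; pour t₁ b ;; pour t₂ a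

/-- Effect and cost of `swap` (scratch registers empty before and after). [folklore] -/
theorem runs_swap {a b t₁ t₂ : K} (hab : a ≠ b) (ha1 : a ≠ t₁) (ha2 : a ≠ t₂) (hb1 : b ≠ t₁)
    (hb2 : b ≠ t₂) (h12 : t₁ ≠ t₂) (R : Store) (h1 : R t₁ = []) (h2 : R t₂ = []) :
    Runs (swap a b t₁ t₂) R (Function.update (Function.update R a (R b)) b (R a))
      (6 * ((R a).length + (R b).length) + 4) := by
  unfold swap
  have e1 := runs_pour (a := a) (b := t₁) ha1 R
  rw [h1, List.append_nil] at e1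
  set R₁ := Function.update (Function.update R a []) t₁ (R a).reverse with hR₁
  have e2 := runs_pour (a := b) (b := t₂) hb2 R₁
  have hR₁b : R₁ b = R b := by simp [hR₁, Function.update_of_ne hb1, Function.update_of_ne hab.symm]
  have hR₁t2 : R₁ t₂ = [] := by
    simp [hR₁, Function.update_of_ne h12.symm, Function.update_of_ne ha2.symm, h2]
  rw [hR₁b, hR₁t2, List.append_nil] at e2
  set R₂ := Function.update (Function.update R₁ b []) t₂ (R b).reverse with hR₂
  have e3 := runs_pour (a := t₁) (b := b) hb1.symm R₂
  have hR₂t1 : R₂ t₁ = (R a).reverse := by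
    simp [hR₂, hR₁, Function.update_of_ne h12, Function.update_of_ne hb1.symm]
  have hR₂b : R₂ b = [] := by simp [hR₂, Function.update_of_ne hb2]
  rw [hR₂t1, hR₂b, List.length_reverse, List.reverse_reverse, List.append_nil] at e3
  set R₃ := Function.update (Function.update R₂ t₁ []) b (R a) with hR₃
  have e4 := runs_pour (a := t₂) (b := a) ha2.symm R₃
  have hR₃t2 : R₃ t₂ = (R b).reverse := by
    simp [hR₃, hR₂, Function.update_of_ne hb2.symm, Function.update_of_ne h12.symm]
  have hR₃a : R₃ a = [] := by
    simp [hR₃, hR₂, hR₁, Function.update_of_ne hab, Function.update_of_ne ha1,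
      Function.update_of_ne ha2]
  rw [hR₃t2, hR₃a, List.length_reverse, List.reverse_reverse, List.append_nil] at e4
  refine (e1.seq (e2.seq (e3.seq e4))).of_eq ?_ (by omega)
  rw [hR₃, hR₂, hR₁]
  funext r
  rcases eq_or_ne a r with rfl | hra
  · simp [Function.update_of_ne hab]
  · rcases eq_or_ne b r with rfl | hrb
    · simp [Function.update_of_ne hb2, Function.update_of_ne hab.symm]
    · rcases eq_or_ne t₁ r with rfl | hr1
      · simp [Function.update_of_ne ha1.symm, Function.update_of_ne h12,
          Function.update_of_ne hb1.symm, h1]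
      · rcases eq_or_ne t₂ r with rfl | hr2
        · simp [Function.update_of_ne ha2.symm, Function.update_of_ne hb2.symm, h2]
        · simp [Function.update_of_ne hra.symm, Function.update_of_ne hrb.symm,
            Function.update_of_ne hr1.symm, Function.update_of_ne hr2.symm]

/-- `pourCount src dst cn`: pour `src` onto `dst` (reversing), pushing one blank on `cn` per
comma moved — so that pouring a reversed clause body restores it and counts its literals.
[folklore] -/
def pourCount (src dst cn : K) : Prog :=
  loop src fun a => push dst a ;; match a with
    | Γ'.comma => push cn Γ'.blank
    | _ => skip

/-- Effect and cost of `pourCount`. [folklore] -/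
theorem runs_pourCount {src dst cn : K} (h1 : src ≠ dst) (h2 : src ≠ cn) (h3 : dst ≠ cn)
    (R : Store) :
    Runs (pourCount src dst cn) R
      (Function.update (Function.update (Function.update R src []) dst ((R src).reverse ++ R dst))
        cn (unary ((R src).count Γ'.comma) ++ R cn)) (4 * (R src).length + 1) := by
  unfold pourCount
  have h := runs_loop_inv (k := src) (f := fun a => push dst a ;; match a with
      | Γ'.comma => push cn Γ'.blank
      | _ => skip)
    (fun done rest => Function.update (Function.update (Function.update R src rest) dst
      (done ++ R dst)) cn (unary (done.count Γ'.comma) ++ R cn))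
    (fun _ _ => True) 2
    (fun done rest _ => by simp [Function.update_of_ne h1, Function.update_of_ne h2])
    (fun done a rest _ => ⟨trivial, by
      set T₀ := Function.update (Function.update (Function.update (Function.update R src
        (a :: rest)) dst (done ++ R dst)) cn (unary (done.count Γ'.comma) ++ R cn)) src rest
        with hT₀
      have e1 := Runs.push dst a T₀
      set T₁ := Function.update T₀ dst (a :: T₀ dst) with hT₁
      have hfin : ∀ extra : List Γ', (extra = if a = Γ'.comma then [Γ'.blank] else []) →
          Function.update T₁ cn (extra ++ T₁ cn) =
          Function.update (Function.update (Function.update R src rest) dst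
            (a :: done ++ R dst)) cn (unary ((a :: done).count Γ'.comma) ++ R cn) := by
        intro extra he
        rw [hT₁, hT₀, he, List.count_cons]
        funext r
        rcases eq_or_ne src r with rfl | hrs
        · simp [Function.update_of_ne h1, Function.update_of_ne h2]
        · rcases eq_or_ne dst r with rfl | hrd
          · simp [Function.update_of_ne h3, Function.update_of_ne h1.symm]
          · rcases eq_or_ne cn r with rfl | hrc
            · by_cases hac : a = Γ'.comma
              · simp [hac, Function.update_of_ne h3.symm, Function.update_of_ne h2.symm,
                  unary_succ]
              · simp [hac, Function.update_of_ne h3.symm, Function.update_of_ne h2.symm]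
            · simp [Function.update_of_ne hrs.symm, Function.update_of_ne hrd.symm,
                Function.update_of_ne hrc.symm]
      cases a with
      | comma =>
        have e2 := Runs.push cn Γ'.blank T₁
        refine (e1.seq e2).of_eq ?_ (by norm_num)
        simpa using hfin [Γ'.blank] (by simp)
      | _ =>
        refine (e1.seq (Runs.skip T₁)).of_eq ?_ (by norm_num)
        simpa using hfin [] (by simp)⟩)
    (R src) [] trivial
  simp only [List.nil_append, List.count_nil, unary_zero, Function.update_eq_self,
    List.append_nil, List.count_reverse] at h
  exact h.mono (by omega)

/-- A clause body contains one comma per literal. [folklore] -/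
theorem count_comma_cbody (c : List Lit) : (cbody c).count Γ'.comma = c.length := by
  induction c with
  | nil => simp
  | cons l c ih =>
    rw [cbody_cons, List.count_append, List.count_cons, ih,
      List.count_eq_zero.2 (comma_not_mem_litBody l)]
    simp

/-! ### Generic pass over a family word, clause by clause -/

/-- Body of a generic pass over a family word held in some register: save every symbol on `sv`,
accumulate the current clause body (reversed) on `ca`, and at its closing bracket run `act`.
[folklore] -/
def famPass (sv ca : K) (act : Prog) (a : Γ') : Prog :=
  push sv a ;;
  match a with
  | Γ'.bra => skip
  | Γ'.ket => act
  | _ => push ca a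

/-- Symbols of clause bodies are bits or commas. [folklore] -/
theorem mem_cbody {c : List Lit} {a : Γ'} (h : a ∈ cbody c) : a = Γ'.comma ∨ ∃ b, a = Γ'.bit b := by
  induction c with
  | nil => simp at h
  | cons l c ih =>
    rw [cbody_cons, List.mem_append, List.mem_cons] at h
    rcases h with h | rfl | h
    · exact Or.inr (mem_litBody h)
    · exact Or.inl rfl
    · exact ih h

/-- No opening bracket in a clause body. [folklore] -/
theorem bra_not_mem_cbody (c : List Lit) : Γ'.bra ∉ cbody c := fun h => by
  rcases mem_cbody h with h | ⟨b, h⟩ <;> cases h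

/-- No closing bracket in a clause body. [folklore] -/
theorem ket_not_mem_cbody (c : List Lit) : Γ'.ket ∉ cbody c := fun h => by
  rcases mem_cbody h with h | ⟨b, h⟩ <;> cases h

/-- No blank in a clause body. [folklore] -/
theorem blank_not_mem_cbody (c : List Lit) : Γ'.blank ∉ cbody c := fun h => by
  rcases mem_cbody h with h | ⟨b, h⟩ <;> cases h

/-- No blank in a family word. [folklore] -/
theorem blank_not_mem_wFam (F : List (List Lit)) : Γ'.blank ∉ wFam F := by
  induction F with
  | nil => simp
  | cons c F ih => simp [wFam_cons, blank_not_mem_cbody c, ih]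

/-- The accumulation segment of `famPass` over bracket-free symbols. [folklore] -/
theorem segRuns_famPass_body {reg sv ca : K} (act : Prog) (h1 : reg ≠ sv) (h2 : reg ≠ ca)
    (h3 : sv ≠ ca) : ∀ (bs : List Γ') (_ : Γ'.bra ∉ bs) (_ : Γ'.ket ∉ bs) (T : Store)
    (v : List Γ') (_ : T reg = bs ++ v),
    SegRuns reg (famPass sv ca act) bs T
      (Function.update (Function.update (Function.update T reg v) sv (bs.reverse ++ T sv))
        ca (bs.reverse ++ T ca)) (4 * bs.length)
  | [], _, _, T, v, hc => by
    refine (SegRuns.nil reg _ T).of_eq ?_ (by simp)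
    rw [List.nil_append] at hc
    simp [← hc]
  | a :: bs, hbra, hket, T, v, hc => by
    have ha1 : a ≠ Γ'.bra := fun h => hbra (h ▸ List.mem_cons_self)
    have ha2 : a ≠ Γ'.ket := fun h => hket (h ▸ List.mem_cons_self)
    have hbra' : Γ'.bra ∉ bs := fun h => hbra (List.mem_cons_of_mem _ h)
    have hket' : Γ'.ket ∉ bs := fun h => hket (List.mem_cons_of_mem _ h)
    set T₁ : Store := Function.update (Function.update (Function.update T reg (bs ++ v)) sv
      (a :: T sv)) ca (a :: T ca) with hT₁
    have hbody : Runs (famPass sv ca act a) (Function.update T reg (bs ++ v)) T₁ 2 := by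
      have e1 := Runs.push sv a (Function.update T reg (bs ++ v))
      have e2 := Runs.push ca a
        (Function.update (Function.update T reg (bs ++ v)) sv
          (a :: Function.update T reg (bs ++ v) sv))
      have e12 := e1.seq e2
      have e : (push sv a ;; push ca a : Prog) = famPass sv ca act a := by
        cases a with
        | bra => exact absurd rfl ha1
        | ket => exact absurd rfl ha2
        | _ => rfl
      rw [e] at e12
      refine e12.of_eq ?_ (by norm_num)
      simp only [hT₁]
      funext r
      rcases eq_or_ne sv r with rfl | hsv
      · simp [Function.update_of_ne h3, Function.update_of_ne h1.symm]
      · rcases eq_or_ne ca r with rfl | hac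
        · simp [Function.update_of_ne h3.symm, Function.update_of_ne h2.symm]
        · simp [Function.update_of_ne hsv.symm, Function.update_of_ne hac.symm]
    have ih := segRuns_famPass_body act h1 h2 h3 bs hbra' hket' T₁ v (by
      simp [hT₁, Function.update_of_ne h2, Function.update_of_ne h1])
    refine (SegRuns.cons hc hbody ih).of_eq ?_ (by simp; omega)
    simp only [hT₁]
    funext r
    rcases eq_or_ne reg r with rfl | hrg
    · simp [Function.update_of_ne h2, Function.update_of_ne h1]
    · rcases eq_or_ne sv r with rfl | hsv
      · simp [Function.update_of_ne h3]
      · rcases eq_or_ne ca r with rfl | hac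
        · simp
        · simp [Function.update_of_ne hsv.symm, Function.update_of_ne hac.symm,
            Function.update_of_ne hrg.symm]

/-- The store just before the action of `famPass`: the clause `c` has been consumed from `reg`
(with its brackets), saved reversed on `sv`, its body accumulated reversed on `ca`.
[folklore] -/
def famPre (reg sv ca : K) (S : Store) (c : List Lit) (rest : List (List Lit)) : Store :=
  Function.update (Function.update (Function.update S reg (wFam rest)) sv
    ((Γ'.bra :: cbody c ++ [Γ'.ket]).reverse ++ S sv)) ca ((cbody c).reverse ++ S ca)

/-- **Generic family pass.** Let `St done rest` describe the store at the clause boundary after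
the clauses `done` have been processed and `rest` remain in `reg`, with `ca` empty there. If
the action leads from `famPre reg sv ca (St done (c :: rest)) c rest` to `St (done ++ [c]) rest`
within `B` whenever `|cbody c| ≤ W`, then the pass leads from `St done rest` to
`St (done ++ rest) []` within `(4 W + B + 6) |rest| + 1`. [folklore] -/
theorem runs_famPass {reg sv ca : K} (act : Prog) (h1 : reg ≠ sv) (h2 : reg ≠ ca)
    (h3 : sv ≠ ca) (St : List (List Lit) → List (List Lit) → Store) (full : List (List Lit))
    (W B : ℕ)
    (hreg : ∀ done rest, St done rest reg = wFam rest)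
    (hcacc : ∀ done rest, St done rest ca = [])
    (hact : ∀ done c rest, done ++ c :: rest = full → (cbody c).length ≤ W →
      Runs act (famPre reg sv ca (St done (c :: rest)) c rest) (St (done ++ [c]) rest) B) :
    ∀ (rest done : List (List Lit)), done ++ rest = full → (∀ c ∈ rest, (cbody c).length ≤ W) →
      Runs (loop reg (famPass sv ca act)) (St done rest) (St (done ++ rest) [])
        ((4 * W + B + 6) * rest.length + 1)
  | [], done, _, _ => by
    simpa using Runs.loop_nil (famPass sv ca act) (R := St done []) (by simpa using hreg done [])
  | c :: rest, done, hfull, hW => by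
    have hc := hW c List.mem_cons_self
    have hr0 : St done (c :: rest) reg = Γ'.bra :: (cbody c ++ Γ'.ket :: wFam rest) := by
      rw [hreg, wFam_cons]; simp
    -- the opening bracket
    set T₁ : Store := Function.update (Function.update (St done (c :: rest)) reg
      (cbody c ++ Γ'.ket :: wFam rest)) sv (Γ'.bra :: St done (c :: rest) sv) with hT₁
    have hbra : Runs (famPass sv ca act Γ'.bra)
        (Function.update (St done (c :: rest)) reg (cbody c ++ Γ'.ket :: wFam rest)) T₁ 1 := by
      have := (Runs.push sv Γ'.bra (Function.update (St done (c :: rest)) reg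
        (cbody c ++ Γ'.ket :: wFam rest))).seq (Runs.skip _)
      exact this.of_eq (by simp [hT₁, Function.update_of_ne h1.symm]) (by norm_num)
    have hseg1 := SegRuns.single (f := famPass sv ca act) hr0 hbra
    -- the body
    have hT₁reg : T₁ reg = cbody c ++ Γ'.ket :: wFam rest := by
      simp [hT₁, Function.update_of_ne h1]
    have hseg2 := segRuns_famPass_body act h1 h2 h3 (cbody c) (bra_not_mem_cbody c)
      (ket_not_mem_cbody c) T₁ (Γ'.ket :: wFam rest) hT₁reg
    set T₂ : Store := Function.update (Function.update (Function.update T₁ reg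
      (Γ'.ket :: wFam rest)) sv ((cbody c).reverse ++ T₁ sv)) ca
      ((cbody c).reverse ++ T₁ ca) with hT₂
    -- the closing bracket
    have hT₂reg : T₂ reg = Γ'.ket :: wFam rest := by
      simp [hT₂, Function.update_of_ne h2, Function.update_of_ne h1]
    have hpush : Runs (push sv Γ'.ket) (Function.update T₂ reg (wFam rest))
        (famPre reg sv ca (St done (c :: rest)) c rest) 1 := by
      refine Runs.push' ?_
      simp only [famPre, hT₂, hT₁, hcacc]
      funext r
      rcases eq_or_ne reg r with rfl | hrg
      · simp [Function.update_of_ne h1, Function.update_of_ne h2]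
      · rcases eq_or_ne sv r with rfl | hsv
        · simp [Function.update_of_ne h3, Function.update_of_ne h1.symm]
        · rcases eq_or_ne ca r with rfl | hac
          · simp [Function.update_of_ne h2.symm, Function.update_of_ne h3.symm, hcacc]
          · simp [Function.update_of_ne hsv.symm, Function.update_of_ne hac.symm,
              Function.update_of_ne hrg.symm]
    have hket : Runs (famPass sv ca act Γ'.ket) (Function.update T₂ reg (wFam rest))
        (St (done ++ [c]) rest) (1 + B) :=
      hpush.seq (hact done c rest hfull hc)
    have hseg3 := SegRuns.single (f := famPass sv ca act) hT₂reg hket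
    have ih := runs_famPass act h1 h2 h3 St full W B hreg hcacc hact rest (done ++ [c])
      (by rw [List.append_assoc]; exact hfull) (fun c' h => hW c' (List.mem_cons_of_mem _ h))
    rw [List.append_assoc, List.singleton_append] at ih
    have := ((hseg1.append hseg2).append hseg3).runs_loop ih
    refine this.mono ?_
    simp only [List.length_cons]
    nlinarith

end Literature.Computability.FineGrained.Sparsifier
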